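import Literature.Probability.RandomPlanarGeometry.HexParafermionTransport
import Literature.Probability.RandomPlanarGeometry.HexSAWLattice

/-!
# `NoFoldBound` (route SAWDevelopingMap, item stmt-CriticalPhenomena-8296): the local turns

Stub `stub_localTurns` (W6) of the line `Ideator3Sketch` for the crux
`Summit.CriticalPhenomena.SAWScalingLimit.Theses.SAWDevelopingMap.NoFoldBound`.

At a vertex `v` of the honeycomb lattice `ℍ` with its three neighbours `p, q, r`, the one-step
turn of the DCS parafermionic walk entering `v` through the mid-edge `{p, v}` and leaving through
`{v, q}` — the winding of the three-point polyline `mid{p,v} → c(v) → mid{v,q}` — is `±π/3`; the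
three "cyclic" turns `p → q`, `q → r`, `r → p` have one common sign `ε = ±1` (according as
`(p, q, r)` is the clockwise or the counter-clockwise order of the neighbours) and the three
reversed turns the opposite sign (**`stub_localTurns`**).

Proof: the one-step winding is the turning angle `c(p) → c(v) → c(q)` (the mid-edges lie on the
two segments, `HV.turning_left_ray` / `HV.turning_right_ray`); a chart of the dart `p → v`
(`HV.exists_chart`: a graph isomorphism `Φ : hexGraph ≃g hvGraph` onto the coordinate model,
complex-affine on embedded positions, with `Φ p = wOut`, `Φ v = hvOrigin`) transports it to
`(π/3) · HV.turn` (`HV.turning_affine`, `HV.turning_emb_pos`), and the six turns between the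
three neighbours `wOut = (0,-1,1)`, `(0,0,1)`, `(-1,0,1)` of `hvOrigin` are evaluated by `decide`.
-/

noncomputable section

open Literature.Probability.LatticeModels Literature.Probability.RandomPlanarGeometry.SAW

namespace Summit.CriticalPhenomena.SAWScalingLimit.Theorems.SAWDevelopingMapNoFoldBound

/-- The one-step winding `mid{a,v} → c(v) → mid{v,b}` is the turning angle of
`c(a) → c(v) → c(b)` (the two mid-edges lie on the two segments through `c(v)`). -/
theorem winding_step_eq_turning (a v b : HexVertex) :
    winding [hexMidpoint s(a, v), hexCenter v, hexMidpoint s(v, b)] =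
      turning (hexCenter a) (hexCenter v) (hexCenter b) := by
  rw [winding_cons_cons_cons, winding_pair, add_zero, hexMidpoint_mk, hexMidpoint_mk,
    show (hexCenter a + hexCenter v) / 2 =
        hexCenter v + ((1 / 2 : ℝ) : ℂ) * (hexCenter a - hexCenter v) by push_cast; ring,
    show (hexCenter v + hexCenter b) / 2 =
        hexCenter v + ((1 / 2 : ℝ) : ℂ) * (hexCenter b - hexCenter v) by push_cast; ring,
    HV.turning_left_ray (by norm_num : (0 : ℝ) < 1 / 2),
    HV.turning_right_ray (by norm_num : (0 : ℝ) < 1 / 2)]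

/-- In a complex-affine chart `Φ : hexGraph ≃g hvGraph` the one-step winding
`mid{a,v} → c(v) → mid{v,b}` (`a ≠ b` neighbours of `v`) is `(π/3) · turn (Φ a) (Φ v) (Φ b)`. -/
theorem winding_step_eq_turn {Φ : hexGraph ≃g hvGraph} {α β : ℂ} (hα : α ≠ 0)
    (hΦ : ∀ f, HV.emb (HV.pos (Φ f)) = α * hexCenter f + β) {a v b : HexVertex}
    (ha : hexGraph.Adj v a) (hb : hexGraph.Adj v b) (hab : a ≠ b) :
    winding [hexMidpoint s(a, v), hexCenter v, hexMidpoint s(v, b)] =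
      (Real.pi / 3) * HV.turn (Φ a) (Φ v) (Φ b) := by
  rw [winding_step_eq_turning, ← HV.turning_affine hα β, ← hΦ, ← hΦ, ← hΦ]
  exact HV.turning_emb_pos ((Φ.map_rel_iff).2 ha.symm) ((Φ.map_rel_iff).2 hb)
    (fun h => hab (Φ.injective h))

/-- A neighbour of `hvOrigin` in the coordinate model is `(0,0,1)`, `(-1,0,1)` or `wOut`. -/
theorem eq_of_adj_hvOrigin {w : HV} (hw : hvGraph.Adj hvOrigin w) :
    w = (0, 0, true) ∨ w = (-1, 0, true) ∨ w = HV.wOut := by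
  have := (hvGraph_adj_iff_mem_nbrs _ _).1 hw
  simpa [hvOrigin, HV.nbrs, HV.wOut] using this

/-- **Stub W6 (local turns).** At a honeycomb vertex `v` with its three neighbours `p, q, r`, the
six one-step turns `mid{·,v} → c(v) → mid{v,·}` are `±π/3`, with the cyclic ones `p→q, q→r, r→p`
of one sign and the anticyclic ones of the other. -/
theorem stub_localTurns :
    ∀ (v p q r : HexVertex), hexGraph.Adj v p → hexGraph.Adj v q → hexGraph.Adj v r →
      p ≠ q → q ≠ r → p ≠ r →
      ∃ ε : ℝ, (ε = 1 ∨ ε = -1) ∧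
        winding [hexMidpoint s(p, v), hexCenter v, hexMidpoint s(v, q)] = ε * (Real.pi / 3) ∧
        winding [hexMidpoint s(q, v), hexCenter v, hexMidpoint s(v, r)] = ε * (Real.pi / 3) ∧
        winding [hexMidpoint s(r, v), hexCenter v, hexMidpoint s(v, p)] = ε * (Real.pi / 3) ∧
        winding [hexMidpoint s(q, v), hexCenter v, hexMidpoint s(v, p)] = -(ε * (Real.pi / 3)) ∧
        winding [hexMidpoint s(r, v), hexCenter v, hexMidpoint s(v, q)] = -(ε * (Real.pi / 3)) ∧
        winding [hexMidpoint s(p, v), hexCenter v, hexMidpoint s(v, r)] = -(ε * (Real.pi / 3)) := by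
  intro v p q r hp hq hr hpq hqr hpr
  obtain ⟨Φ, α, β, hα, hΦp, hΦv, hΦ⟩ := HV.exists_chart hp.symm
  have hq' : hvGraph.Adj hvOrigin (Φ q) := by rw [← hΦv]; exact (Φ.map_rel_iff).2 hq
  have hr' : hvGraph.Adj hvOrigin (Φ r) := by rw [← hΦv]; exact (Φ.map_rel_iff).2 hr
  have hpq' : Φ q ≠ HV.wOut := fun h => hpq (Φ.injective (hΦp.trans h.symm))
  have hpr' : Φ r ≠ HV.wOut := fun h => hpr (Φ.injective (hΦp.trans h.symm))
  have hqr' : Φ q ≠ Φ r := fun h => hqr (Φ.injective h)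
  rw [winding_step_eq_turn hα hΦ hp hq hpq, winding_step_eq_turn hα hΦ hq hr hqr,
    winding_step_eq_turn hα hΦ hr hp hpr.symm, winding_step_eq_turn hα hΦ hq hp hpq.symm,
    winding_step_eq_turn hα hΦ hr hq hqr.symm, winding_step_eq_turn hα hΦ hp hr hpr, hΦp, hΦv]
  rcases eq_of_adj_hvOrigin hq' with eq | eq | eq
  · rcases eq_of_adj_hvOrigin hr' with er | er | er
    · exact absurd (eq.trans er.symm) hqr'
    · rw [eq, er]
      refine ⟨-1, Or.inr rfl, ?_⟩
      simp only [show HV.turn HV.wOut hvOrigin (0, 0, true) = -1 by decide,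
        show HV.turn (0, 0, true) hvOrigin (-1, 0, true) = -1 by decide,
        show HV.turn (-1, 0, true) hvOrigin HV.wOut = -1 by decide,
        show HV.turn (0, 0, true) hvOrigin HV.wOut = 1 by decide,
        show HV.turn (-1, 0, true) hvOrigin (0, 0, true) = 1 by decide,
        show HV.turn HV.wOut hvOrigin (-1, 0, true) = 1 by decide]
      push_cast
      refine ⟨?_, ?_, ?_, ?_, ?_, ?_⟩ <;> ring
    · exact absurd er hpr'
  · rcases eq_of_adj_hvOrigin hr' with er | er | er
    · rw [eq, er]
      refine ⟨1, Or.inl rfl, ?_⟩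
      simp only [show HV.turn HV.wOut hvOrigin (-1, 0, true) = 1 by decide,
        show HV.turn (-1, 0, true) hvOrigin (0, 0, true) = 1 by decide,
        show HV.turn (0, 0, true) hvOrigin HV.wOut = 1 by decide,
        show HV.turn (-1, 0, true) hvOrigin HV.wOut = -1 by decide,
        show HV.turn (0, 0, true) hvOrigin (-1, 0, true) = -1 by decide,
        show HV.turn HV.wOut hvOrigin (0, 0, true) = -1 by decide]
      push_cast
      refine ⟨?_, ?_, ?_, ?_, ?_, ?_⟩ <;> ring
    · exact absurd (eq.trans er.symm) hqr'
    · exact absurd er hpr'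
  · exact absurd eq hpq'

end Summit.CriticalPhenomena.SAWScalingLimit.Theorems.SAWDevelopingMapNoFoldBound

end
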